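import Summits.Ventures.CertifiedManyBodySolver.Observables.SourcedRowsThermodynamicLimit
import Literature.MathematicalPhysics.QuantumLattice.DWaveSourceNNNHoppingFlatTwistEnergyDensitySymmetry
import HarnessLib

/-!
# Row T8 «sourced helicity chord»: energy cells for the FLAT-TWISTED pair-sourced `t–t'` tori, and the word
# `X ≤ σ(h, q) ≤ Y` on the thermodynamic-limit helicity chord density read from certified rows BY NAME

HONEST FRAMING: zero compute; first certified bounds; not a superconductivity verdict; every number certified or
labelled float — and this file carries NO number: every statement takes certified energy cells as HYPOTHESES. The
helicity chord at fixed `h > 0` is an energy difference of two certifiable Hamiltonians; a floor `X > 0` on it is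
NOT «helicity ⇒ superconductivity» (free fermions in a pairing field have full stiffness, card K3) and NOT a floor on
any order parameter; what it buys is stated on the card (exclusion of the twist-inert witness class). Row status:
PROPOSED / EMPTY-BY-PRICE (census (60): informative only with a sourced floor of L4 class at `h_tree ≈ 0.4`).

Venture `CertifiedManyBodySolver`, cell `hubbard-cq` (rung CQ, CQ-TABLE T8; card `sourced-helicity-chord`, obst-1 g3;
critic-2 binding verdict SURVIVES-as-instrument-row 03:16Z 08-27), seat `hubbard-cq-p5` (lead RULING 136 (ii): the
row consumer). OBJECTS (all in the tree): the T8 Hamiltonian `dWaveSourceTorusTT'Twist L tp U μ h n` (flat twist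
`χ_L(n_i)` per unit bond = wave vector `q = 4πn/L`, untwisted `d`-wave source; hubbard-cq-p5
`DWaveSourceNNNHoppingFlatTwist.lean`), its thermodynamic-limit energy density
`e^tw(tp,U,μ,h;κ) = dWaveSourceEnergyDensityTT'Twist tp U μ h κ` (`κ ∈ U(1)²` the bond phase; hubbard-cq-p3
`…FlatTwistLocalDensity.lean` + hubbard-cq-p5 `…FlatTwistEnergyDensity/ThermodynamicLimit/…Symmetry.lean`: the limit of
`E₀(Twist L_j n_j)/L_j²` along EVERY sequence with `χ_{L_j}(n_j) = κ`, `= e_src` at `κ = 1`, `= e_src(0)` at `h = 0`),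
and the untwisted cells `SourcedEnergyLowerRow / UpperRow tp U μ h q L₀ e` of `Rows/SourcedTorusRows.lean`
(hubbard-cq-obsth-1) with their `e_src` readers (`Observables/SourcedRowsThermodynamicLimit.lean`, obsth-2).

* §1 CELLS (rational slots, mirror of the untwisted ones): `TwistedSourcedTorusEnergyLowerRow / UpperRow L tp U μ h n e`
  (`e·L² ≤ E₀(Twist L n)`, resp. `≥`; one torus, any twist) and the LADDER cells
  `TwistedSourcedEnergyLowerRow / UpperRow tp U μ h b p L₀ e` — on every side `L = b·k ≥ L₀` the twist `n = p·k`
  (fixed `q = 4πp/b`: `b = 8, p = (1,0)` is `q = (π/2)·x̂`, `b = 16` is `(π/4)·x̂`); hooks `…UpperRow.of_trial`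
  (any unit trial vector — the conclusion shape of the spiral cluster-cap producer
  `Upper/DWaveSourceOpenClusterCapSpiral.lean`) and `…LowerRow.of_le` (any certified `c·L² ≤ E₀` with `e ≤ c`).
* §2 CELLS ⇒ `e^tw`: a ladder floor cell is `e ≤ e^tw(tp,U,μ,h; χ_b(p))`, a ladder cap cell is `e^tw ≤ e'`
  (`TwistedSourcedEnergyLowerRow.le_dWaveSourceEnergyDensityTT'Twist`, `…UpperRow.dWaveSourceEnergyDensityTT'Twist_le`);
  CONSISTENCY: a twisted floor cell never exceeds an untwisted `h = 0` cap cell on ANY progression (`e ≤ e'₀`, since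
  `e^tw(h;κ) ≤ e_src(0)`) — the cross-check every new K-class twisted floor must pass against the rows of record.
* §3 THE WORD on `σ(h; b, p) := e^tw(tp,U,μ,h; χ_b(p)) − e_src(tp,U,μ,h)` (`sourcedHelicityDensity`, the limit of the
  card's `ΔE_L(h, q)/L²` along `L ∈ bℕ`, `tendsto_sourcedHelicityChord_div_sq_ladder`): always
  `σ ≤ G(h) = e_src(0) − e_src(h)` and `σ(0) = 0`; FLOOR `e − e' ≤ σ` from a twisted floor cell `e` and an untwisted cap
  cell `e'` at field `h` (`sourcedHelicityDensity_floor_of_rows`); CEILING `σ ≤ e' − e` from a twisted cap cell `e'` and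
  an untwisted floor cell `e` at field `h` (`…_ceiling_of_rows`); GAIN CEILING `σ ≤ e'₀ − e_h` from the untwisted cap
  at `h = 0` and floor at `h`; LOCKING sentence (critic-2 clause R-a): a certified ceiling `Y = e' − e` with
  `Y < e₀ − e'_h ≤ G(h)` certifies `σ < G(h)` — the induced condensate stays LOCKED to the source and pays twist energy
  (`sourcedHelicityDensity_lt_gain_of_rows`); a helicity floor is a GAIN floor (`gain_floor_of_helicity_floor`).
* §4 the finite-torus readings of the same word (one torus, no limit): `(e − e')·L² ≤ ΔE_L`, `ΔE_L ≤ (e' − e)·L²`.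

No named fact, no `sorry`; four `def`s (the cells and `σ`), everything else PROVED.

References: T. Koma, H. Tasaki, J. Stat. Phys. 76 (1994) 745, §1 [cite: KomaTasaki1994, §1]; H. Watanabe,
J. Stat. Phys. 177 (2019) 717, §2.2.1–§2.2.3 [cite: Watanabe2019, §2.2.1]; M. E. Fisher, M. N. Barber, D. Jasnow,
Phys. Rev. A 8 (1973) 1111 (helicity modulus as a twist free-energy difference) [cite: FisherBarberJasnow1973];
D. Ruelle, *Statistical Mechanics* (1969) §3.3 [cite: Ruelle1969, §3.3].
-/

noncomputable section

namespace Summit.Ventures.CertifiedManyBodySolver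

open Literature.MathematicalPhysics.QuantumLattice Literature.Probability.LatticeModels HubbardWave0 _root_.Filter _root_.Matrix
open scoped _root_.Topology

/-! ## §1  The cells -/

/-- §1 (TWISTED ENERGY FLOOR, one torus). `e · L² ≤ E₀(dWaveSourceTorusTT'Twist L tp U μ h n)` (`E₀` on the whole Fock
space). -/
def TwistedSourcedTorusEnergyLowerRow (L : ℕ) [NeZero L] (tp U μ h : ℝ) (n : Fin 2 → ZMod L) (e : ℚ) : Prop :=
  ((e : ℚ) : ℝ) * (L : ℝ) ^ 2 ≤ (dWaveSourceTorusTT'Twist L tp U μ h n).groundEnergy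

/-- §1 (TWISTED ENERGY CEILING, one torus). `E₀(dWaveSourceTorusTT'Twist L tp U μ h n) ≤ e · L²`. -/
def TwistedSourcedTorusEnergyUpperRow (L : ℕ) [NeZero L] (tp U μ h : ℝ) (n : Fin 2 → ZMod L) (e : ℚ) : Prop :=
  (dWaveSourceTorusTT'Twist L tp U μ h n).groundEnergy ≤ ((e : ℚ) : ℝ) * (L : ℝ) ^ 2

/-- §1 (TWISTED ENERGY FLOOR, ladder). On every side `L = b·k ≥ L₀` (`k ≥ 1`), with the twist `n = p·k` of fixed wave
vector `q = 4πp/b`: `e · L² ≤ E₀(Twist L n)` — the shape of a constant-complex-phase sourced lower-bound certificate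
that holds on every large torus of the ladder. -/
def TwistedSourcedEnergyLowerRow (tp U μ h : ℝ) (b : ℕ) [NeZero b] (p : Fin 2 → ℕ) (L₀ : ℕ) (e : ℚ) : Prop :=
  ∀ (k : ℕ) [NeZero k], L₀ ≤ b * k →
    TwistedSourcedTorusEnergyLowerRow (b * k) tp U μ h (fun i => ((p i * k : ℕ) : ZMod (b * k))) e

/-- §1 (TWISTED ENERGY CEILING, ladder). On every side `L = b·k ≥ L₀`, twist `n = p·k`: `E₀(Twist L n) ≤ e · L²` (block
trial states). -/
def TwistedSourcedEnergyUpperRow (tp U μ h : ℝ) (b : ℕ) [NeZero b] (p : Fin 2 → ℕ) (L₀ : ℕ) (e : ℚ) : Prop :=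
  ∀ (k : ℕ) [NeZero k], L₀ ≤ b * k →
    TwistedSourcedTorusEnergyUpperRow (b * k) tp U μ h (fun i => ((p i * k : ℕ) : ZMod (b * k))) e

/-- **The thermodynamic-limit sourced helicity chord density** of the ladder `q = 4πp/b`:
`σ(tp,U,μ,h; b, p) = e^tw(tp,U,μ,h; χ_b(p)) − e_src(tp,U,μ,h)` — the limit of the card's `ΔE_L(h, q)/L²` along
`L ∈ bℕ` (`tendsto_sourcedHelicityChord_div_sq_ladder`). -/
def sourcedHelicityDensity (tp U μ h : ℝ) (b : ℕ) [NeZero b] (p : Fin 2 → ℕ) : ℝ :=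
  dWaveSourceEnergyDensityTT'Twist tp U μ h (fun i => ZMod.toCircle ((p i : ℕ) : ZMod b)) -
    dWaveSourceEnergyDensityTT' tp U μ h

variable {L : ℕ} [NeZero L] {tp U μ h : ℝ} {e e' e₀ : ℚ} {b : ℕ} [NeZero b] {p : Fin 2 → ℕ} {q q' L₀ L₀' L₁ : ℕ}

/-- Monotonicity of the floor slot. -/
theorem TwistedSourcedTorusEnergyLowerRow.mono {n : Fin 2 → ZMod L} (hrow : TwistedSourcedTorusEnergyLowerRow L tp U μ h n e)
    (he : e' ≤ e) : TwistedSourcedTorusEnergyLowerRow L tp U μ h n e' :=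
  le_trans (mul_le_mul_of_nonneg_right (by exact_mod_cast he) (sq_nonneg _)) hrow

/-- Monotonicity of the ceiling slot. -/
theorem TwistedSourcedTorusEnergyUpperRow.mono {n : Fin 2 → ZMod L} (hrow : TwistedSourcedTorusEnergyUpperRow L tp U μ h n e)
    (he : e ≤ e') : TwistedSourcedTorusEnergyUpperRow L tp U μ h n e' :=
  le_trans hrow (mul_le_mul_of_nonneg_right (by exact_mod_cast he) (sq_nonneg _))

/-- **Hook (floor)**: any certified bound `c · L² ≤ E₀(Twist L n)` with `e ≤ c` is the floor cell. -/
theorem TwistedSourcedTorusEnergyLowerRow.of_le {n : Fin 2 → ZMod L} {c : ℝ} (he : ((e : ℚ) : ℝ) ≤ c)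
    (hE : c * (L : ℝ) ^ 2 ≤ (dWaveSourceTorusTT'Twist L tp U μ h n).groundEnergy) :
    TwistedSourcedTorusEnergyLowerRow L tp U μ h n e :=
  le_trans (mul_le_mul_of_nonneg_right he (sq_nonneg _)) hE

/-- **Hook (ceiling, trial state)**: a unit vector with Rayleigh quotient `≤ e · L²` in the twisted sourced torus gives
the ceiling cell (the variational principle; the block-product vectors of `Upper/DWaveSourceOpenClusterCapSpiral.lean`
are such vectors). -/
theorem TwistedSourcedTorusEnergyUpperRow.of_trial {n : Fin 2 → ZMod L} {φ : Fock (Orb (FermionTorus 2 L))}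
    (hφ : star φ ⬝ᵥ φ = 1)
    (hle : (star φ ⬝ᵥ dWaveSourceTorusTT'Twist L tp U μ h n *ᵥ φ).re ≤ ((e : ℚ) : ℝ) * (L : ℝ) ^ 2) :
    TwistedSourcedTorusEnergyUpperRow L tp U μ h n e :=
  (Matrix.groundEnergy_le_rayleigh_holds (isHermitian_dWaveSourceTorusTT'Twist L tp U μ h n) φ hφ).trans hle

/-- **Hook (ceiling)**: any certified bound `E₀(Twist L n) ≤ c · L²` with `c ≤ e` is the ceiling cell (the output
shape of `groundEnergy_dWaveSourceTorusTT'Twist_le_div_mul_sq`). -/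
theorem TwistedSourcedTorusEnergyUpperRow.of_le {n : Fin 2 → ZMod L} {c : ℝ} (he : c ≤ ((e : ℚ) : ℝ))
    (hE : (dWaveSourceTorusTT'Twist L tp U μ h n).groundEnergy ≤ c * (L : ℝ) ^ 2) :
    TwistedSourcedTorusEnergyUpperRow L tp U μ h n e :=
  le_trans hE (mul_le_mul_of_nonneg_right he (sq_nonneg _))

/-- At zero twist the twisted floor cell is the untwisted one (`L ≥ 3`). -/
theorem TwistedSourcedTorusEnergyLowerRow.iff_untwisted_of_zero (hL : 3 ≤ L) :
    TwistedSourcedTorusEnergyLowerRow L tp U μ h 0 e ↔ SourcedTorusEnergyLowerRow L tp U μ h e := by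
  rw [TwistedSourcedTorusEnergyLowerRow, dWaveSourceTorusTT'Twist_zero_twist L hL, SourcedTorusEnergyLowerRow.iff_le_groundEnergy]

/-- Monotonicity of the ladder floor cell in the slot and the threshold. -/
theorem TwistedSourcedEnergyLowerRow.mono (hrow : TwistedSourcedEnergyLowerRow tp U μ h b p L₀ e) (he : e' ≤ e)
    (hL : L₀ ≤ L₁) : TwistedSourcedEnergyLowerRow tp U μ h b p L₁ e' :=
  fun k _ hk => (hrow k (le_trans hL hk)).mono he

/-- Monotonicity of the ladder ceiling cell in the slot and the threshold. -/
theorem TwistedSourcedEnergyUpperRow.mono (hrow : TwistedSourcedEnergyUpperRow tp U μ h b p L₀ e) (he : e ≤ e')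
    (hL : L₀ ≤ L₁) : TwistedSourcedEnergyUpperRow tp U μ h b p L₁ e' :=
  fun k _ hk => (hrow k (le_trans hL hk)).mono he

/-! ## §2  Cells ⇒ the thermodynamic-limit twisted energy density `e^tw` -/

/-- The ladder sides `b(m+1)` diverge. -/
private theorem tendsto_ladder (b : ℕ) [NeZero b] : Tendsto (fun m : ℕ => b * (m + 1)) atTop atTop :=
  (tendsto_add_atTop_nat 1).const_mul_atTop' (Nat.pos_of_ne_zero (NeZero.ne b))

/-- **A ladder FLOOR cell is a floor on `e^tw`**: `TwistedSourcedEnergyLowerRow tp U μ h b p L₀ e` gives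
`e ≤ e^tw(tp,U,μ,h; χ_b(p))`. [cite: Ruelle1969, §3.3] -/
theorem TwistedSourcedEnergyLowerRow.le_dWaveSourceEnergyDensityTT'Twist (hrow : TwistedSourcedEnergyLowerRow tp U μ h b p L₀ e) :
    ((e : ℚ) : ℝ) ≤ dWaveSourceEnergyDensityTT'Twist tp U μ h (fun i => ZMod.toCircle ((p i : ℕ) : ZMod b)) := by
  refine dWaveSourceEnergyDensityTT'Twist_ge_of_eventually_le tp U μ h _ (fun m => b * (m + 1)) (tendsto_ladder b)
    (fun m i => ((p i * (m + 1) : ℕ) : ZMod (b * (m + 1)))) (fun m i => toCircle_mul_eq b (m + 1) (p i)) ?_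
  filter_upwards [(tendsto_ladder b).eventually_ge_atTop L₀] with m hm
  exact hrow (m + 1) hm

/-- **A ladder CEILING cell is a ceiling on `e^tw`**: `TwistedSourcedEnergyUpperRow tp U μ h b p L₀ e` gives
`e^tw(tp,U,μ,h; χ_b(p)) ≤ e`. [cite: Ruelle1969, §3.3] -/
theorem TwistedSourcedEnergyUpperRow.dWaveSourceEnergyDensityTT'Twist_le (hrow : TwistedSourcedEnergyUpperRow tp U μ h b p L₀ e) :
    dWaveSourceEnergyDensityTT'Twist tp U μ h (fun i => ZMod.toCircle ((p i : ℕ) : ZMod b)) ≤ ((e : ℚ) : ℝ) := by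
  refine dWaveSourceEnergyDensityTT'Twist_le_of_eventually_le tp U μ h _ (fun m => b * (m + 1)) (tendsto_ladder b)
    (fun m i => ((p i * (m + 1) : ℕ) : ZMod (b * (m + 1)))) (fun m i => toCircle_mul_eq b (m + 1) (p i)) ?_
  filter_upwards [(tendsto_ladder b).eventually_ge_atTop L₀] with m hm
  exact hrow (m + 1) hm

/-- **Consistency of a twisted floor with a twisted cap** (same ladder): `e ≤ e'`. -/
theorem TwistedSourcedEnergyLowerRow.le_of_upperRow (hlo : TwistedSourcedEnergyLowerRow tp U μ h b p L₀ e)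
    (hhi : TwistedSourcedEnergyUpperRow tp U μ h b p L₀' e') : e ≤ e' := by
  exact_mod_cast hlo.le_dWaveSourceEnergyDensityTT'Twist.trans hhi.dWaveSourceEnergyDensityTT'Twist_le

/-- **CONSISTENCY CROSS-CHECK against the rows of record**: a twisted floor cell at ANY field `h` never exceeds an
untwisted CAP cell at `h = 0` on any progression `q ≥ 1` (`e ≤ e^tw(h;κ) ≤ e_src(0) ≤ e'₀`) — the test every new
constant-phase sourced floor must pass. [cite: KomaTasaki1994, §1] -/
theorem TwistedSourcedEnergyLowerRow.le_of_sourcedUpperRow_zero (hlo : TwistedSourcedEnergyLowerRow tp U μ h b p L₀ e)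
    (hhi : SourcedEnergyUpperRow tp U μ 0 q L₀' e') (hq : 0 < q) : e ≤ e' := by
  have h1 := hlo.le_dWaveSourceEnergyDensityTT'Twist
  have h2 := dWaveSourceEnergyDensityTT'Twist_le_zero_source tp U μ h _ (fun m => b * (m + 1)) (tendsto_ladder b)
    (fun m i => ((p i * (m + 1) : ℕ) : ZMod (b * (m + 1)))) (fun m i => toCircle_mul_eq b (m + 1) (p i))
  have h3 := hhi.dWaveSourceEnergyDensityTT'_le hq
  exact_mod_cast h1.trans (h2.trans h3)

/-! ## §3  The word `X ≤ σ(h, q) ≤ Y` on the helicity chord density -/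

/-- **The finite chords converge to `σ`** along the ladder: `(E₀(Twist (b(m+1)) (p(m+1))) − E₀(A_{b(m+1)}(h)))/(b(m+1))²
→ σ(tp,U,μ,h; b, p)`. [cite: Ruelle1969, §3.3] -/
theorem tendsto_sourcedHelicityChord_div_sq_ladder (tp U μ h : ℝ) (b : ℕ) [NeZero b] (p : Fin 2 → ℕ) :
    Tendsto (fun m : ℕ => ((dWaveSourceTorusTT'Twist (b * (m + 1)) tp U μ h
        (fun i => ((p i * (m + 1) : ℕ) : ZMod (b * (m + 1))))).groundEnergy -
        (dWaveSourceTorusTT' (b * (m + 1)) tp U μ h).groundEnergy) / (((b * (m + 1) : ℕ) : ℝ)) ^ 2) atTop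
      (𝓝 (sourcedHelicityDensity tp U μ h b p)) :=
  tendsto_sourcedHelicityChord_div_sq tp U μ h _ (fun m => b * (m + 1)) (tendsto_ladder b) _
    (fun m i => toCircle_mul_eq b (m + 1) (p i))

/-- **`σ ≤ G(h)`**: the helicity chord density never exceeds the sourced gain density `e_src(0) − e_src(h)` (the card's
`helicityChord_le_gain`, on the tree's objects, hypotheses `gauge0`/`varq` discharged). [cite: KomaTasaki1994, §1] -/
theorem sourcedHelicityDensity_le_gain (tp U μ h : ℝ) (b : ℕ) [NeZero b] (p : Fin 2 → ℕ) :
    sourcedHelicityDensity tp U μ h b p ≤ dWaveSourceEnergyDensityTT' tp U μ 0 - dWaveSourceEnergyDensityTT' tp U μ h :=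
  helicityChordDensity_ladder_le_sourcedGainDensity tp U μ h b p

/-- **`σ(0) = 0`**: at zero source the flat twist is invisible (the card's `gauge0`, a theorem). [cite: Watanabe2019, §2.2.1] -/
theorem sourcedHelicityDensity_zero_source (tp U μ : ℝ) (b : ℕ) [NeZero b] (p : Fin 2 → ℕ) :
    sourcedHelicityDensity tp U μ 0 b p = 0 := by
  rw [sourcedHelicityDensity, dWaveSourceEnergyDensityTT'Twist_ladder_zero_source, sub_self]

/-- **FLOOR TRANSPORT** (`helicityFloor_of_rows` on the tree's objects): a twisted ladder floor cell `e` at field `h` and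
an untwisted cap cell `e'` at the same field (any progression `q ≥ 1`, e.g. the job-U canonical uppers) give
`e − e' ≤ σ(tp,U,μ,h; b, p)`. [cite: KomaTasaki1994, §1] -/
theorem sourcedHelicityDensity_floor_of_rows (hlo : TwistedSourcedEnergyLowerRow tp U μ h b p L₀ e)
    (hhi : SourcedEnergyUpperRow tp U μ h q L₀' e') (hq : 0 < q) :
    ((e : ℚ) : ℝ) - ((e' : ℚ) : ℝ) ≤ sourcedHelicityDensity tp U μ h b p :=
  sub_le_sub hlo.le_dWaveSourceEnergyDensityTT'Twist (hhi.dWaveSourceEnergyDensityTT'_le hq)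

/-- **CEILING TRANSPORT** (`helicityCeiling_of_rows`): a twisted ladder cap cell `e'` (e.g. the spiral cluster cap) and an
untwisted floor cell `e` at field `h` (any progression `q ≥ 1`, e.g. a K-class sourced floor) give
`σ(tp,U,μ,h; b, p) ≤ e' − e`. [cite: KomaTasaki1994, §1] -/
theorem sourcedHelicityDensity_ceiling_of_rows (hhi : TwistedSourcedEnergyUpperRow tp U μ h b p L₀ e')
    (hlo : SourcedEnergyLowerRow tp U μ h q L₀' e) (hq : 0 < q) :
    sourcedHelicityDensity tp U μ h b p ≤ ((e' : ℚ) : ℝ) - ((e : ℚ) : ℝ) :=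
  sub_le_sub hhi.dWaveSourceEnergyDensityTT'Twist_le (hlo.le_dWaveSourceEnergyDensityTT' hq)

/-- **GAIN CEILING from the rows of record**: an untwisted cap cell `e₀` at `h = 0` and an untwisted floor cell `e` at
field `h` (arbitrary progressions) give `σ ≤ G(h) ≤ e₀ − e` — the a-priori ceiling of the word, no twisted certificate
needed. [cite: KomaTasaki1994, §1] -/
theorem sourcedHelicityDensity_le_of_gain_rows (hhi : SourcedEnergyUpperRow tp U μ 0 q L₀ e₀)
    (hlo : SourcedEnergyLowerRow tp U μ h q' L₀' e) (hq : 0 < q) (hq' : 0 < q') :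
    sourcedHelicityDensity tp U μ h b p ≤ ((e₀ : ℚ) : ℝ) - ((e : ℚ) : ℝ) :=
  (sourcedHelicityDensity_le_gain tp U μ h b p).trans
    (sub_le_sub (hhi.dWaveSourceEnergyDensityTT'_le hq) (hlo.le_dWaveSourceEnergyDensityTT' hq'))

/-- **A helicity floor is a gain floor** (`gainFloor_of_helicityFloor`): `δ ≤ σ ⇒ δ ≤ G(h)` — a certified helicity floor
is checked against the cell's GAIN numbers of record. [cite: KomaTasaki1994, §1] -/
theorem gain_floor_of_helicity_floor {δ : ℝ} (hδ : δ ≤ sourcedHelicityDensity tp U μ h b p) :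
    δ ≤ dWaveSourceEnergyDensityTT' tp U μ 0 - dWaveSourceEnergyDensityTT' tp U μ h :=
  hδ.trans (sourcedHelicityDensity_le_gain tp U μ h b p)

/-- **LOCKING SENTENCE** (critic-2 clause R-a): a certified ceiling `Y = e' − e` on `σ` (twisted cap `e'`, untwisted floor
`e` at field `h`) together with untwisted cells certifying `Y < G(h)` — a floor `e₀` at `h = 0` and a cap `e'_h` at
`h` with `e' − e < e₀ − e'_h` — gives `σ < G(h)`: the induced condensate does not unlock from the source at this twist.
[cite: FisherBarberJasnow1973] -/
theorem sourcedHelicityDensity_lt_gain_of_rows {e'ₕ : ℚ} (hhi : TwistedSourcedEnergyUpperRow tp U μ h b p L₀ e')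
    (hlo : SourcedEnergyLowerRow tp U μ h q L₀' e) (hq : 0 < q) (hlo₀ : SourcedEnergyLowerRow tp U μ 0 q' L₁ e₀)
    (hq' : 0 < q') {q'' L₂ : ℕ} (hhiₕ : SourcedEnergyUpperRow tp U μ h q'' L₂ e'ₕ) (hq'' : 0 < q'')
    (hY : e' - e < e₀ - e'ₕ) :
    sourcedHelicityDensity tp U μ h b p < dWaveSourceEnergyDensityTT' tp U μ 0 - dWaveSourceEnergyDensityTT' tp U μ h := by
  have h1 := sourcedHelicityDensity_ceiling_of_rows hhi hlo hq
  have h2 := hlo₀.le_dWaveSourceEnergyDensityTT' hq'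
  have h3 := hhiₕ.dWaveSourceEnergyDensityTT'_le hq''
  have hY' : ((e' : ℚ) : ℝ) - ((e : ℚ) : ℝ) < ((e₀ : ℚ) : ℝ) - ((e'ₕ : ℚ) : ℝ) := by exact_mod_cast hY
  linarith

/-- The floor word stated as a POSITIVITY sentence: a twisted floor cell `e` and an untwisted cap cell `e'` at field `h`
with `e' < e` certify `0 < σ(h, q)` (which excludes the twist-inert witness class of the card; it is NOT a floor on
any order parameter). [cite: FisherBarberJasnow1973] -/
theorem sourcedHelicityDensity_pos_of_rows (hlo : TwistedSourcedEnergyLowerRow tp U μ h b p L₀ e)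
    (hhi : SourcedEnergyUpperRow tp U μ h q L₀' e') (hq : 0 < q) (hgap : e' < e) :
    0 < sourcedHelicityDensity tp U μ h b p := by
  have h1 := sourcedHelicityDensity_floor_of_rows hlo hhi hq
  have hgap' : ((e' : ℚ) : ℝ) < ((e : ℚ) : ℝ) := by exact_mod_cast hgap
  linarith

/-! ## §4  The same word on ONE torus (no limit) -/

/-- **Finite-torus floor**: a twisted floor cell and an untwisted cap cell on the same torus give
`(e − e')·L² ≤ E₀(Twist L n) − E₀(A_L(h))`. -/
theorem twistedChord_floor_of_torusRows {n : Fin 2 → ZMod L} (hlo : TwistedSourcedTorusEnergyLowerRow L tp U μ h n e)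
    (hhi : SourcedTorusEnergyUpperRow L tp U μ h e') :
    (((e : ℚ) : ℝ) - ((e' : ℚ) : ℝ)) * (L : ℝ) ^ 2 ≤
      (dWaveSourceTorusTT'Twist L tp U μ h n).groundEnergy - (dWaveSourceTorusTT' L tp U μ h).groundEnergy := by
  rw [sub_mul]
  exact sub_le_sub hlo (SourcedTorusEnergyUpperRow.iff_groundEnergy_le.1 hhi)

/-- **Finite-torus ceiling**: a twisted cap cell and an untwisted floor cell on the same torus give
`E₀(Twist L n) − E₀(A_L(h)) ≤ (e' − e)·L²`. -/
theorem twistedChord_ceiling_of_torusRows {n : Fin 2 → ZMod L} (hhi : TwistedSourcedTorusEnergyUpperRow L tp U μ h n e')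
    (hlo : SourcedTorusEnergyLowerRow L tp U μ h e) :
    (dWaveSourceTorusTT'Twist L tp U μ h n).groundEnergy - (dWaveSourceTorusTT' L tp U μ h).groundEnergy ≤
      (((e' : ℚ) : ℝ) - ((e : ℚ) : ℝ)) * (L : ℝ) ^ 2 := by
  rw [sub_mul]
  exact sub_le_sub hhi (SourcedTorusEnergyLowerRow.iff_le_groundEnergy.1 hlo)

/-- **Finite-torus gain cap** (`L ≥ 3`): the chord on one torus is below that torus' sourced gain, hence below
`(e₀ − e)·L²` for an untwisted cap cell `e₀` at `h = 0` and floor cell `e` at `h` on the same torus.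
[cite: KomaTasaki1994, §1] -/
theorem twistedChord_le_of_torusGainRows (hL : 3 ≤ L) {n : Fin 2 → ZMod L}
    (hhi : SourcedTorusEnergyUpperRow L tp U μ 0 e₀) (hlo : SourcedTorusEnergyLowerRow L tp U μ h e) :
    (dWaveSourceTorusTT'Twist L tp U μ h n).groundEnergy - (dWaveSourceTorusTT' L tp U μ h).groundEnergy ≤
      (((e₀ : ℚ) : ℝ) - ((e : ℚ) : ℝ)) * (L : ℝ) ^ 2 := by
  rw [sub_mul]
  exact (sourcedHelicityChord_le_sourcedGain L hL tp U μ h n).trans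
    (sub_le_sub (SourcedTorusEnergyUpperRow.iff_groundEnergy_le.1 hhi) (SourcedTorusEnergyLowerRow.iff_le_groundEnergy.1 hlo))

end Summit.Ventures.CertifiedManyBodySolver

end
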